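import Summits.QuantumFields.YangMills.Theorems.BalabanUVNodesN07W23OfRecordTraceSectors
import Summits.QuantumFields.YangMills.Theorems.UnitScaleTiltProp7V0CurrentCentralDerivT3
import HarnessLib

/-!
# NODE N07 — THE WHOLE `W`-LETTER OF def-Y's SCHEME OF RECORD MAPS HERMITIAN TRACELESS JETS TO TRACELESS CURRENTS AT `N = 2`: the `V₀`-current `curV0` of (63)∕(90) is
# TRACELESS-valued on traceless-presented jets over the `SU(2)` background (`V₀` is even along central lines: `W + W⁻¹ = (tr W)·1` on `SL(2)`, ✓`Prop7V0CurrentCentralDeriv`), the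
# pulled-back group `curV0full = (DT)ᵗ curV0 ∘ T` keeps that (`DT(A′)` fixes `δ_b·1`), and with ✓`…N07W23OfRecordTraceSectors` (`W₁`, `W₂`, `W₃`):
# ★★★ `trace_WOfRecordAt_eq_zero_two` — the TRACE HALF of the «`W` maps `evHerm0` into `TZ`» ROW of ✓`Node00.BgSchemeChartLie.lieTokAt_of_rows`, complementing ✓p822996
# `WOfRecordAt_herm` ([15] (26) p. 282, (39) p. 284, (63) p. 287, (80)–(96) pp. 290–292; [B9] (3.2)–(3.7) pp. 390–391)

Cell `pub-ymgap`, width seat `pub-ymgap-dag-n07-w3` (g27), CLAIM-5.  `--kind proof --supports stmt-QuantumFields-27238 --as helper`; count-neutral.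
[15] = [Balaban1985Variational]; [B9] = [Balaban1985BackgroundPropagators].

THE ARGUMENT (§2).  By lit's (63) certificate ✓`bondPair_curV0`, `η^d·tr(curV0(Y)(b)) = ⟨curV0 Y, δ_b·1⟩ = (d/dt)V₀(A + t·δ_b1)|₀` with `A = Y` read as a bond function; by (30)∕(39)
`V₀ = Σ_p η^d (V′₀(·, ∂p) + term39(·, ∂p))` (lit ✓`eq30a`, `V0primeP`); along the CENTRAL line `A + t·δ_b1` the (39)-term is constant (✓`term39_add_smul_central`) and each
`V′₀(·, ∂p)` has zero derivative at `0` for `τ = tr` on `M₂(ℂ)`, a determinant-one background and a traceless `A` (✓`deriv_V0primeP_central_eq_zero_M2`: `P⁻¹ = adj P`).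
* §1 `det_coe_Ucur_unitsOfRecord`, `curL_single_one` (the one-bond scalar direction is a central line), `V0p_eq_V0primeP_add_term39`.
* §2 ★★`trace_curV0OfRecord_eq_zero_two` — `curV0 (ρ, tr, U₀) Y` is traceless at every bond for traceless-presented `Y` (`N = 2`).
* §3 ★★`trace_curV0fullOfRecord_eq_zero_two` — at def-Y's letters, for Hermitian traceless `A′`, `‖A′‖ < a_C` (guard; regime, `Prop4Hyp`, `hCreal`, `hCtr` displayed).
* §4 ★★★`trace_WOfRecordAt_eq_zero_two` — `W = WOfRecordAt levB a hpos♭ hQ ε_C G′` at `N = 2` is traceless-valued on such `A′` (`G′` commuting with `S` displayed).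

HONEST LABELS.  Bookkeeping over lit's (26)∕(63) letters and the cited `SL(2)` facts; Sect. C's regime, `Prop4Hyp`, `hCreal`, `hCtr`, the guard and the data row `hGp` are DISPLAYED, not proved; an
`N = 2` statement (at `N ≥ 3` the tree's complexified `V₀` keeps a scalar channel).  Count-neutral; N07 NOT discharged; P0 ⟨26900⟩ OPEN; R4 is the conditional finite-𝕋⁴ rung only.  Nothing
here is a claim about the Yang–Mills mass gap (`Summit.QuantumFields`): finite torus, fixed `ε`; nothing continuum ∕ OS ∕ Clay.
-/

set_option autoImplicit false

noncomputable section

open scoped Matrix Matrix.Norms.L2Operator InnerProductSpace ComplexConjugate BigOperators Topology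

namespace Summit.QuantumFields.YangMills.Theorems.N07WOfRecordTraceSectors

open Filter Metric
open Literature.MathematicalPhysics.QuantumFieldTheory.Balaban1983to89
open Literature.MathematicalPhysics.QuantumFieldTheory.Balaban1983to89.T4Continuum (T4Family)
open T4Continuum BlockAveraging
open B4Sect5Torus (TSite)
open B9SectCLatticeCarrier (Bond)
open B9Eq39Adjoint (posPlaq)
open B11Eq26ActionExpansion (V0 V0p eq30a)
open B11Eq90V0primeBond (term39 V0primeP contDiff_V0primeP)
open B11Eq90V0primeCurrent (Tsh Ucur curL curL_apply flat115 flat115_apply)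
open B11Eq90Transpose (pair27 pair27_def pair27_single transCur single115)
open B11Eq63V0GroupCurrent (curV0 bondPair_curV0)
open B11Eq90V0GroupComposed (T47 curV0full curV0full_apply)
open B11Eq80Current (Emap E3 W1 W2 W3 W80)
open B11Eq103H1Complex (SiteL2K BondL2K)
open B11Eq111FrakG (nabla115)
open B11Eq115Space (NegSize NegSup levWeight JetSup)
open B11Eq174Chart (Regime)
open B11Prop6Scheme (Prop4Hyp)
open Node00
open Summit.QuantumFields.YangMills.Theorems.N07TraceSectorDefs (scalPartW)
open Summit.QuantumFields.YangMills.Theorems.Prop7V0CurrentCentralDeriv (deriv_V0primeP_central_eq_zero_M2 term39_add_smul_central)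
open Summit.QuantumFields.YangMills.Theorems.N07EmapOfRecordTraceSectors (fderiv_T47OfRecord_apply_eq_self trace_equiv_T47OfRecord_eq_zero_two)
open Summit.QuantumFields.YangMills.Theorems.N07W23OfRecordTraceSectors (trace_transCur_apply_of_apply_single_eq_self slProjLit_single115_one trace_W1OfRecord_eq_zero
  trace_W3OfRecord_eq_zero trace_W2OfRecord_eq_zero_two)

/-! ## §1  Bookkeeping at the record -/

section Book

variable (F : T4Family) (N : ℕ) (K : ℕ) (U₀ : GaugeField (F.P K) 0 (SU N))

/-- The bond variables of record have determinant one (`U₀(b) ∈ SU(N)`). [cite: Balaban1985BackgroundPropagators, (3.1) p.390 (bookkeeping)] -/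
theorem det_coe_Ucur_unitsOfRecord (μ : Fin (F.P K).d) (x : TSite (F.P K).d (fun _ => (F.P K).sitesPerDir 0)) :
    ((Ucur (unitsOfRecord F N U₀) μ x : (Matrix (Fin N) (Fin N) ℂ)ˣ) : Matrix (Fin N) (Fin N) ℂ).det = 1 := by
  show ((unitsOfRecord F N U₀ (x, μ) : (Matrix (Fin N) (Fin N) ℂ)ˣ) : Matrix (Fin N) (Fin N) ℂ).det = 1
  rw [coe_unitsOfRecord]
  exact (Matrix.mem_specialUnitaryGroup_iff.mp (U₀ _).2).2

/-- **The one-bond scalar direction `δ_b·1` read as a curried bond function is a CENTRAL line direction** `(κ, y) ↦ 𝟙_{(y,κ) = b}·1`. [cite: Balaban1985Variational, (63) p.287 (bookkeeping)] -/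
theorem curL_single_one [DecidableEq (Bond (F.P K).d (fun _ => (F.P K).sitesPerDir 0))] (b₀ : Bond (F.P K).d (fun _ => (F.P K).sitesPerDir 0)) :
    curL (Pi.single b₀ (1 : Matrix (Fin N) (Fin N) ℂ)) =
      fun κ y => (if (y, κ) = b₀ then (1 : ℂ) else 0) • (1 : Matrix (Fin N) (Fin N) ℂ) := by
  funext κ y
  rw [curL_apply, Pi.single_apply]
  split_ifs <;> simp

end Book

/-- `V₀(A, ∂p) = V′₀(A, ∂p) + term39(A, ∂p)` ((39) read as a splitting of lit's `V0p`). [cite: Balaban1985Variational, (39) p.284 (bookkeeping)] -/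
theorem V0p_eq_V0primeP_add_term39 {𝔸 : Type*} [NormedRing 𝔸] [NormedAlgebra ℂ 𝔸] [CompleteSpace 𝔸] {S : Type*} {ι : Type*} (T : ι → Equiv.Perm S) (U : ι → S → 𝔸ˣ)
    (η : ℝ) (τ : 𝔸 →ₗ[ℂ] ℂ) (A : ι → S → 𝔸) (μ ν : ι) (x : S) :
    V0p T U η τ A μ ν x = V0primeP T U η τ A μ ν x + term39 T U η τ A μ ν x := by
  rw [V0primeP, sub_add_cancel]

/-! ## §2  The `V₀`-current of record kills the centre at `N = 2` -/

section CurV0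

variable (F : T4Family) (K : ℕ) (k : ℕ) (Ω : ℕ → Set (Site (F.P K) 0)) (U₀ : GaugeField (F.P K) 0 (SU 2))
  [Fact (0 < (F.L : ℝ))] [Fact (0 < (F.P K).eta k)]

set_option maxHeartbeats 800000 in
/-- ★★ **THE `V₀`-CURRENT OF RECORD IS TRACELESS-VALUED ON TRACELESS-PRESENTED JETS AT `N = 2`**: for `Y` of the space (115) with `tr Y(b) = 0` at every bond,
`tr (curV0 (ρ, tr, U₀) Y)(b) = 0` — `⟨curV0 Y, δ_b1⟩ = (d/dt)V₀(Y + tδ_b1)|₀` (lit ✓`bondPair_curV0`) and `V₀` has zero derivative along central lines over a determinant-one `2 × 2` background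
(✓`deriv_V0primeP_central_eq_zero_M2`, ✓`term39_add_smul_central`, lit ✓`eq30a`). [cite: Balaban1985Variational, (63) p.287, (90) p.291, (26) p.282, (30) p.282, (39) p.284; Balaban1985BackgroundPropagators, (3.7) p.391] -/
theorem trace_curV0OfRecord_eq_zero_two {Y : Space115Lit F 2 K k Ω U₀}
    (hY : ∀ b, (JetSup.equiv _ _ (nabla115 ((F.P K).eta k) (unitsOfRecord F 2 U₀)) Y b).trace = 0) (b₀ : Bond (F.P K).d (fun _ => (F.P K).sitesPerDir 0)) :
    (NegSup.equiv (levWeight (F.L : ℝ) ((F.P K).eta k) (bondLevLit F Ω k) 3) (Matrix (Fin 2) (Fin 2) ℂ)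
      (curV0 (rhoRec 2) (tauRecCLM 2) (unitsOfRecord F 2 U₀) Y) b₀).trace = 0 := by
  classical
  have hd : 4 ≤ (F.P K).d := by rw [T4Family.P_d]
  have hηpos : (0 : ℝ) < (F.P K).eta k := Fact.out
  have hη : ((F.P K).eta k : ℝ) ≠ 0 := hηpos.ne'
  have hτc : ∀ a b : Matrix (Fin 2) (Fin 2) ℂ, tauRecCLM 2 (a * b) = tauRecCLM 2 (b * a) := tauRecCLM_mul_comm 2
  have hτl : ∀ a b : Matrix (Fin 2) (Fin 2) ℂ, (tauRecCLM 2 : Matrix (Fin 2) (Fin 2) ℂ →ₗ[ℂ] ℂ) (a * b) = (tauRecCLM 2 : Matrix (Fin 2) (Fin 2) ℂ →ₗ[ℂ] ℂ) (b * a) :=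
    fun a b => hτc a b
  have hτ : ∀ X : Matrix (Fin 2) (Fin 2) ℂ, tauRecCLM 2 X = X.trace := tauRecCLM_apply 2
  set Kc := curV0 (rhoRec 2) (tauRecCLM 2) (unitsOfRecord F 2 U₀) Y with hKc
  -- (a) the pairing against `δ_{b₀}·1` is `η^d·tr Kc(b₀)`
  have hpair : pair27 (tauRecCLM 2) Kc (Pi.single b₀ (1 : Matrix (Fin 2) (Fin 2) ℂ)) =
      (((F.P K).eta k : ℝ) : ℂ) ^ (F.P K).d * (NegSup.equiv (levWeight (F.L : ℝ) ((F.P K).eta k) (bondLevLit F Ω k) 3) (Matrix (Fin 2) (Fin 2) ℂ) Kc b₀).trace := by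
    rw [pair27_single, mul_one, hτ]
  -- (b) … and is the line derivative of `V₀` (lit (63))
  set A : Fin (F.P K).d → TSite (F.P K).d (fun _ => (F.P K).sitesPerDir 0) → Matrix (Fin 2) (Fin 2) ℂ :=
    curL (JetSup.equiv _ _ (nabla115 ((F.P K).eta k) (unitsOfRecord F 2 U₀)) Y) with hA
  set dfun : Fin (F.P K).d → TSite (F.P K).d (fun _ => (F.P K).sitesPerDir 0) → ℂ := fun κ y => if (y, κ) = b₀ then (1 : ℂ) else 0 with hdfun
  have hD : curL (Pi.single b₀ (1 : Matrix (Fin 2) (Fin 2) ℂ)) = fun κ y => dfun κ y • (1 : Matrix (Fin 2) (Fin 2) ℂ) := curL_single_one F 2 K b₀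
  have hderiv : pair27 (tauRecCLM 2) Kc (Pi.single b₀ (1 : Matrix (Fin 2) (Fin 2) ℂ)) =
      deriv (fun t : ℂ => V0 Tsh (Ucur (unitsOfRecord F 2 U₀)) ((F.P K).eta k) (F.P K).d (tauRecCLM 2 : Matrix (Fin 2) (Fin 2) ℂ →ₗ[ℂ] ℂ)
        (A + t • fun κ y => dfun κ y • (1 : Matrix (Fin 2) (Fin 2) ℂ))) 0 := by
    rw [pair27_def, hKc, bondPair_curV0 (rhoRec 2) (tauRecCLM 2) (tauRecCLM_rhoRec_mul 2) hτc hd (unitsOfRecord F 2 U₀) Y, hD]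
  -- (c) the three facts: `τ = tr`, `det U₀ = 1`, `tr A = 0`
  have hU : ∀ μ x, ((Ucur (unitsOfRecord F 2 U₀) μ x : (Matrix (Fin 2) (Fin 2) ℂ)ˣ) : Matrix (Fin 2) (Fin 2) ℂ).det = 1 := det_coe_Ucur_unitsOfRecord F 2 K U₀
  have hAtr : ∀ κ y, (A κ y).trace = 0 := fun κ y => by rw [hA, curL_apply]; exact hY _
  -- (d) the line derivative of `V₀` along the central line vanishes
  have hq : ∀ q : TSite (F.P K).d (fun _ => (F.P K).sitesPerDir 0) × Fin (F.P K).d × Fin (F.P K).d,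
      HasDerivAt (fun t : ℂ => V0primeP Tsh (Ucur (unitsOfRecord F 2 U₀)) ((F.P K).eta k) (tauRecCLM 2 : Matrix (Fin 2) (Fin 2) ℂ →ₗ[ℂ] ℂ)
        (A + t • fun κ y => dfun κ y • (1 : Matrix (Fin 2) (Fin 2) ℂ)) q.2.1 q.2.2 q.1) 0 0 := by
    intro q
    have hdiffq : DifferentiableAt ℂ (fun t : ℂ => V0primeP Tsh (Ucur (unitsOfRecord F 2 U₀)) ((F.P K).eta k) (tauRecCLM 2 : Matrix (Fin 2) (Fin 2) ℂ →ₗ[ℂ] ℂ)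
        (A + t • fun κ y => dfun κ y • (1 : Matrix (Fin 2) (Fin 2) ℂ)) q.2.1 q.2.2 q.1) 0 := by
      have hV := (contDiff_V0primeP Tsh (Ucur (unitsOfRecord F 2 U₀)) (n := 1) ((F.P K).eta k) (tauRecCLM 2) q.2.1 q.2.2 q.1).differentiable (by norm_num)
      have hline : Differentiable ℂ (fun t : ℂ => A + t • fun κ y => dfun κ y • (1 : Matrix (Fin 2) (Fin 2) ℂ)) :=
        (differentiable_const A).add (differentiable_id.smul_const _)
      exact (hV.comp hline).differentiableAt
    have h := hdiffq.hasDerivAt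
    rwa [deriv_V0primeP_central_eq_zero_M2 Tsh (Ucur (unitsOfRecord F 2 U₀)) (tauRecCLM 2) hτ hU ((F.P K).eta k) A hAtr dfun q.2.1 q.2.2 q.1] at h
  have hsum : HasDerivAt (fun t : ℂ => ∑ q ∈ posPlaq (TSite (F.P K).d (fun _ => (F.P K).sitesPerDir 0)) (Fin (F.P K).d),
      ((((F.P K).eta k : ℝ) : ℂ) ^ (F.P K).d * V0primeP Tsh (Ucur (unitsOfRecord F 2 U₀)) ((F.P K).eta k) (tauRecCLM 2 : Matrix (Fin 2) (Fin 2) ℂ →ₗ[ℂ] ℂ)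
          (A + t • fun κ y => dfun κ y • (1 : Matrix (Fin 2) (Fin 2) ℂ)) q.2.1 q.2.2 q.1 +
        (((F.P K).eta k : ℝ) : ℂ) ^ (F.P K).d * term39 Tsh (Ucur (unitsOfRecord F 2 U₀)) ((F.P K).eta k) (tauRecCLM 2 : Matrix (Fin 2) (Fin 2) ℂ →ₗ[ℂ] ℂ) A q.2.1 q.2.2 q.1))
      (∑ q ∈ posPlaq (TSite (F.P K).d (fun _ => (F.P K).sitesPerDir 0)) (Fin (F.P K).d), ((((F.P K).eta k : ℝ) : ℂ) ^ (F.P K).d * 0 + 0)) 0 :=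
    HasDerivAt.fun_sum fun q _ => ((hq q).const_mul _).add (hasDerivAt_const _ _)
  have hfun : (fun t : ℂ => V0 Tsh (Ucur (unitsOfRecord F 2 U₀)) ((F.P K).eta k) (F.P K).d (tauRecCLM 2 : Matrix (Fin 2) (Fin 2) ℂ →ₗ[ℂ] ℂ)
        (A + t • fun κ y => dfun κ y • (1 : Matrix (Fin 2) (Fin 2) ℂ))) =
      fun t : ℂ => ∑ q ∈ posPlaq (TSite (F.P K).d (fun _ => (F.P K).sitesPerDir 0)) (Fin (F.P K).d),
        ((((F.P K).eta k : ℝ) : ℂ) ^ (F.P K).d * V0primeP Tsh (Ucur (unitsOfRecord F 2 U₀)) ((F.P K).eta k) (tauRecCLM 2 : Matrix (Fin 2) (Fin 2) ℂ →ₗ[ℂ] ℂ)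
            (A + t • fun κ y => dfun κ y • (1 : Matrix (Fin 2) (Fin 2) ℂ)) q.2.1 q.2.2 q.1 +
          (((F.P K).eta k : ℝ) : ℂ) ^ (F.P K).d * term39 Tsh (Ucur (unitsOfRecord F 2 U₀)) ((F.P K).eta k) (tauRecCLM 2 : Matrix (Fin 2) (Fin 2) ℂ →ₗ[ℂ] ℂ) A q.2.1 q.2.2 q.1) := by
    funext t
    rw [eq30a Tsh (Ucur (unitsOfRecord F 2 U₀)) (tauRecCLM 2 : Matrix (Fin 2) (Fin 2) ℂ →ₗ[ℂ] ℂ) hτl ((F.P K).eta k) hη hd]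
    refine Finset.sum_congr rfl fun q _ => ?_
    rw [V0p_eq_V0primeP_add_term39, term39_add_smul_central Tsh (Ucur (unitsOfRecord F 2 U₀)) (tauRecCLM 2 : Matrix (Fin 2) (Fin 2) ℂ →ₗ[ℂ] ℂ) hτl, mul_add]
  have hzero : deriv (fun t : ℂ => V0 Tsh (Ucur (unitsOfRecord F 2 U₀)) ((F.P K).eta k) (F.P K).d (tauRecCLM 2 : Matrix (Fin 2) (Fin 2) ℂ →ₗ[ℂ] ℂ)
      (A + t • fun κ y => dfun κ y • (1 : Matrix (Fin 2) (Fin 2) ℂ))) 0 = 0 := by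
    rw [hfun, hsum.deriv]
    simp
  -- (e) conclude: `η^d·tr Kc(b₀) = 0`, `η ≠ 0`
  have hfinal : (((F.P K).eta k : ℝ) : ℂ) ^ (F.P K).d * (NegSup.equiv (levWeight (F.L : ℝ) ((F.P K).eta k) (bondLevLit F Ω k) 3) (Matrix (Fin 2) (Fin 2) ℂ) Kc b₀).trace = 0 := by
    rw [← hpair, hderiv, hzero]
  exact (mul_eq_zero.1 hfinal).resolve_left (pow_ne_zero _ (Complex.ofReal_ne_zero.2 hη))

end CurV0

/-! ## §3  The pulled-back group `curV0full` and §4 the whole `W`, at def-Y's letters, `N = 2` -/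

section W

variable (F : T4Family) (K : ℕ) (k : ℕ) (Ω : ℕ → Set (Site (F.P K) 0)) (U₀ : GaugeField (F.P K) 0 (SU 2))
  [Fact (0 < (F.L : ℝ))] [Fact (0 < (F.P K).eta k)] [Fact (0 < c0Rec F K k)] [Fact (∀ c, 0 < wBRec F K k c)] {a : ℝ}
  (hposb : ∀ x, x ≠ 0 → 0 < RCLike.re ⟪x, laplaceAOfRecord F 2 k U₀ (QOfRecord F 2 k U₀) (QflatOfRecord F 2 k) a x⟫_ℂ)
  (hQ : Function.Surjective (QOfRecord F 2 k U₀)) (levB : PBond (F.P K) k → ℕ) {b C₂ c₄ aC εC : ℝ}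
  {Gp : SiteL2K ℂ (F.P K).d (fun _ => (F.P K).sitesPerDir 0) (c0Rec F K k) (WRec 2) →ₗ[ℂ]
    SiteL2K ℂ (F.P K).d (fun _ => (F.P K).sitesPerDir 0) (c0Rec F K k) (WRec 2)}
  (RC : Regime (H1OfRecordAtBgFlat F 2 K k Ω U₀ levB a hposb hQ) 0 (CslOfRecord F 2 K k Ω U₀ levB) b 0 C₂ c₄ 0 aC εC)
  (hCreal : ∀ A : Space115Lit F 2 K k Ω U₀,
    ((JetSup.equiv _ _ (nabla115 ((F.P K).eta k) (unitsOfRecord F 2 U₀))).symm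
        (star (JetSup.equiv _ _ (nabla115 ((F.P K).eta k) (unitsOfRecord F 2 U₀)) A)) : Space115Lit F 2 K k Ω U₀) = A →
    ‖A‖ ≤ εC + aC → ((NegSup.equiv _ _).symm (star (NegSup.equiv _ _ (CslOfRecord F 2 K k Ω U₀ levB A))) :
      NegSize (F.L : ℝ) ((F.P K).eta k) levB 0 (Matrix (Fin 2) (Fin 2) ℂ)) = CslOfRecord F 2 K k Ω U₀ levB A)
  (hCtr : ∀ A : Space115Lit F 2 K k Ω U₀,
    ((JetSup.equiv _ _ (nabla115 ((F.P K).eta k) (unitsOfRecord F 2 U₀))).symm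
        (star (JetSup.equiv _ _ (nabla115 ((F.P K).eta k) (unitsOfRecord F 2 U₀)) A)) : Space115Lit F 2 K k Ω U₀) = A →
    (∀ b, (JetSup.equiv _ _ (nabla115 ((F.P K).eta k) (unitsOfRecord F 2 U₀)) A b).trace = 0) →
    ‖A‖ ≤ εC + aC → ∀ c, (NegSup.equiv _ _ (CslOfRecord F 2 K k Ω U₀ levB A) c).trace = 0)

include RC hCreal hCtr in
set_option maxHeartbeats 800000 in
/-- ★★ **THE `V₀`-GROUP (90)–(96) `curV0full(A′) = (DT(A′))ᵗ curV0(T A′)` IS TRACELESS-VALUED** at def-Y's letters for Hermitian traceless `A′`, `‖A′‖ < a_C` (`N = 2`; guard, Sect. C regime,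
`Prop4Hyp`, `hCreal`, `hCtr` displayed): `DT(A′)` fixes `δ_b·1` (✓`fderiv_T47OfRecord_apply_eq_self`), so `tr curV0full(A′)(b) = tr curV0(TA′)(b)`, and `T A′` is traceless-presented
(✓`trace_equiv_T47OfRecord_eq_zero_two`). [cite: Balaban1985Variational, (90) p.291, (91)–(96) p.292, (47) p.285] -/
theorem trace_curV0fullOfRecord_eq_zero_two (h : SmallBelow (avOfRecord F 2 K) k U₀) (hP : Prop4Hyp (CslOfRecord F 2 K k Ω U₀ levB) C₂ c₄)
    {A' : Space115Lit F 2 K k Ω U₀}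
    (hA' : ((JetSup.equiv _ _ (nabla115 ((F.P K).eta k) (unitsOfRecord F 2 U₀))).symm
      (star (JetSup.equiv _ _ (nabla115 ((F.P K).eta k) (unitsOfRecord F 2 U₀)) A')) : Space115Lit F 2 K k Ω U₀) = A')
    (hA'tr : ∀ b', (JetSup.equiv _ _ (nabla115 ((F.P K).eta k) (unitsOfRecord F 2 U₀)) A' b').trace = 0) (hn : ‖A'‖ < aC)
    (bd : Bond (F.P K).d (fun _ => (F.P K).sitesPerDir 0)) :
    (NegSup.equiv (levWeight (F.L : ℝ) ((F.P K).eta k) (bondLevLit F Ω k) 3) (Matrix (Fin 2) (Fin 2) ℂ)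
      (curV0full (rhoRec 2) (tauRecCLM 2) (unitsOfRecord F 2 U₀) (H1OfRecordAtBgFlat F 2 K k Ω U₀ levB a hposb hQ) (CslOfRecord F 2 K k Ω U₀ levB) εC A') bd).trace = 0 := by
  rw [curV0full_apply,
    trace_transCur_apply_of_apply_single_eq_self F 2 K k Ω U₀ _
      (fderiv_T47OfRecord_apply_eq_self F 2 K k Ω U₀ levB hposb hQ RC hP (slProjLit_single115_one F 2 K k Ω U₀ bd) hn)]
  exact trace_curV0OfRecord_eq_zero_two F K k Ω U₀ (fun b' => trace_equiv_T47OfRecord_eq_zero_two F k Ω U₀ levB hposb hQ RC hCreal hCtr h hA' hA'tr hn b') bd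

include RC hCreal hCtr in
set_option maxHeartbeats 800000 in
/-- ★★★ **THE `W`-LETTER OF def-Y's SCHEME OF RECORD MAPS HERMITIAN TRACELESS JETS TO TRACELESS CURRENTS AT `N = 2`**: for Hermitian traceless `A′` with `‖A′‖ < a_C` (guard; Sect. C `Regime`,
`Prop4Hyp`, `hCreal`, `hCtr` displayed; `G′` commuting with the scalar part), every bond value of `W A′ = WOfRecordAt levB a hpos♭ hQ ε_C G′ A′ = W₁ + W₂ + W₃ + curV0full` is TRACELESS —
the trace half of the «`W` maps `evHerm0` into `TZ`» ROW of ✓`Node00.BgSchemeChartLie.lieTokAt_of_rows` (the Hermitian half is ✓p822996 `WOfRecordAt_herm`).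
[cite: Balaban1985Variational, (84) p.290, (85)–(96) pp.291–292, (51) p.286, Prop. 6 p.295] -/
theorem trace_WOfRecordAt_eq_zero_two (h : SmallBelow (avOfRecord F 2 K) k U₀) (hP : Prop4Hyp (CslOfRecord F 2 K k Ω U₀ levB) C₂ c₄)
    (hGp : ∀ s, Gp (scalPartW 2 _ s) = scalPartW 2 _ (Gp s)) {A' : Space115Lit F 2 K k Ω U₀}
    (hA' : ((JetSup.equiv _ _ (nabla115 ((F.P K).eta k) (unitsOfRecord F 2 U₀))).symm
      (star (JetSup.equiv _ _ (nabla115 ((F.P K).eta k) (unitsOfRecord F 2 U₀)) A')) : Space115Lit F 2 K k Ω U₀) = A')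
    (hA'tr : ∀ b', (JetSup.equiv _ _ (nabla115 ((F.P K).eta k) (unitsOfRecord F 2 U₀)) A' b').trace = 0) (hn : ‖A'‖ < aC)
    (bd : Bond (F.P K).d (fun _ => (F.P K).sitesPerDir 0)) :
    (NegSup.equiv (levWeight (F.L : ℝ) ((F.P K).eta k) (bondLevLit F Ω k) 3) (Matrix (Fin 2) (Fin 2) ℂ)
      (WOfRecordAt F 2 K k Ω U₀ levB a hposb hQ εC Gp A') bd).trace = 0 := by
  rw [WOfRecordAt_eq, NegSup.equiv_add, NegSup.equiv_add, NegSup.equiv_add, Pi.add_apply, Pi.add_apply, Pi.add_apply, Matrix.trace_add, Matrix.trace_add,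
    Matrix.trace_add, trace_W1OfRecord_eq_zero F 2 K k Ω U₀ hposb hQ levB RC hP _ hn bd, trace_W2OfRecord_eq_zero_two F K k Ω U₀ hposb hQ levB RC hCreal hCtr h hP hGp hA' hA'tr hn bd,
    trace_W3OfRecord_eq_zero F 2 K k Ω U₀ hposb hQ levB RC hP hn bd, trace_curV0fullOfRecord_eq_zero_two F K k Ω U₀ hposb hQ levB RC hCreal hCtr h hP hA' hA'tr hn bd]
  simp

end W

end Summit.QuantumFields.YangMills.Theorems.N07WOfRecordTraceSectors

end
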